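import Summits.QuantumFields.YangMills.Theorems.UnitScaleTiltProp8HalvingQuarterL5
import Summits.QuantumFields.YangMills.Theorems.UnitScaleTiltFlatPortAllSizesAllL
import HarnessLib

/-!
# Route `UnitScaleTilt`, crux K1 child «MinimiserStabilityRegPr» (stmt-QuantumFields-19200), registered stub `stub_halvingStep` (H), branch **(P2-small)**,
# mechanism (α) COVERING ∕ PERIODISATION (OWNER RULING g26-№18, ACK 36, ACK 38) — file **α8 `HalvingQuarterAllSizesAllL`** (= ✓α7 `HalvingQuarterAllSizes` with the binder `(hℓ : 4 ≤ ℓ)` deleted, supplier ✓`FlatPortAllSizesAllL`):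
# **(164) AT THE CUBE SEQUENCE AT EVERY TORUS SIZE** — ✓`HalvingQuarterL5.quarter164_L5` VERBATIM with the single binder `(_ : a′ + 3 ≤ m + n)` DELETED,
# its P2 supplier ✓`FlatPortBodyL0.body_of_adm22` swapped for ★✓`FlatPortAllSizes.body_of_adm22_allSizes` (small members read on their `L^{jc}`-fold cover).

Cell `ym3-torus` (HUMAN RULING D-0037, YM ladder rung R3 — continuum SU(2) YM₃ on the torus is a RUNG, not the Clay problem), explicit-unit helper seat
`ym-ust-19200-w7` gen 0.  `--supports stmt-QuantumFields-19200 --as helper`; count-neutral; def-free, 0 sorry, standard axioms.  The proof is the ✓`quarter164_L5` proof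
with `hsize` deleted (pure supplier swap).  HONEST SCOPE: (P2-L3) `L = 3` remains a Literature-side debt (WANTED №g26-4); the H stub, the crux, the rung and the mass gap
are NOT touched.

References: T. Bałaban, CMP **102** (1985) 277–309 [Balaban1985Variational] (46) p.285, (144) p.300, (160)–(163) p.303, (164) p.304; CMP **96** (1984) 223–250
[Balaban1984PropagatorsII] (2.1)–(2.3) p.224, Cor. 2.8 (2.150)–(2.151) p.249.
-/

set_option autoImplicit false

noncomputable section

open scoped BigOperators

namespace Summit.QuantumFields.YangMills.Theorems.HalvingQuarterAllSizesAllL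

open Literature.MathematicalPhysics.QuantumFieldTheory.Balaban1983to89
open B5Eq117TorusCarriers (Mk)
open B5Eq118OneStroke (iterBlockOf)
open B5Prop12FieldsLattice (distSite)
open B6GlobalChartV1 (PV)
open B6SectADomainsV1 (Domains)
open B6SectAOperatorsV1 (BondIdx dcE dcsE)
open T3ContinuumYM3Torus (T3Family)
open FlatCubeOpsText (Adm22 distBI IsLevWeight IsFlatH IsFlatGt HSupLetterG GtSupLetterG GtLaplaceLetterG HDecayLetterD RowSum162)
open FlatCubeSequenceAligned (cubeSeqMT3)
open FlatCubeSequenceAdm (adm22_cubeSeqMT3)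
open HalvingQuarterCubeSeq (rows164_quarter_cubeSeqMT3_top)
open FlatPortAllSizesAllL (body_of_adm22_allSizes_allL)

/-- `1 ≤ 3` (named once). [folklore] -/
private theorem hd3 : 1 ≤ 2 + 1 := by norm_num

/-- ★ **(164) AT THE CUBE SEQUENCE, UNCONDITIONALLY IN THE P2 TEXT, EVERY ODD `L ≥ 3`, EVERY TORUS SIZE** (✓`quarter164_L5` with the binder `a′ + 3 ≤ m + n` deleted: `FlatPortAllSizes.body_of_adm22_allSizes` +
`FlatCubeSequenceAdm.adm22_cubeSeqMT3` + `HalvingQuarterCubeSeq.rows164_quarter_cubeSeqMT3_top`): see the module docstring for the binder list.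
[cite: Balaban1985Variational, (160)-(163) p.303, (164) p.304; Balaban1984PropagatorsII, (2.1)-(2.2) p.224, Cor. 2.8 (2.150)-(2.151) p.249] -/
theorem quarter164_allSizes_allL (ℓ : ℕ) (hL : Odd (ℓ + 1) ∧ 1 < ℓ + 1) :
    ∃ (Mh₀ R₀ : ℕ) (B₀ δ₀ B₃ : ℝ), 0 ≤ B₀ ∧ 0 < δ₀ ∧ 0 < B₃ ∧
    ∀ (m : ℕ) (hm : 1 ≤ m) (n K : ℕ) (_ : 1 ≤ K - n) (_ : K - n + 1 ≤ m + K) {Mh R a' : ℕ} (_ : Mh = (ℓ + 1) ^ a') (_ : Mh₀ ≤ Mh) (_ : R₀ ≤ R)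
      (hM1 : 1 ≤ (ℓ + 1) * Mh) (x₀ : Site (PV 2 ℓ m K hd3 hL) 0) (ρ S : ℕ) (_ : R * ((ℓ + 1) * Mh) ≤ S)
      (w : ℕ → PBond (PV 2 ℓ m K hd3 hL) 0 → ℝ)
      (_ : IsLevWeight (⟨ℓ + 1, hL, m, hm⟩ : T3Family) n K (cubeSeqMT3 (⟨ℓ + 1, hL, m, hm⟩ : T3Family) n K x₀ ρ S ((ℓ + 1) * Mh) hM1) w),
      ∃ (H : (BondIdx (cubeSeqMT3 (⟨ℓ + 1, hL, m, hm⟩ : T3Family) n K x₀ ρ S ((ℓ + 1) * Mh) hM1) → ℝ) →ₗ[ℝ] (PBond (PV 2 ℓ m K hd3 hL) 0 → ℝ))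
        (Gt : (PBond (PV 2 ℓ m K hd3 hL) 0 → ℝ) →ₗ[ℝ] (PBond (PV 2 ℓ m K hd3 hL) 0 → ℝ)),
        IsFlatH (⟨ℓ + 1, hL, m, hm⟩ : T3Family) n K (cubeSeqMT3 (⟨ℓ + 1, hL, m, hm⟩ : T3Family) n K x₀ ρ S ((ℓ + 1) * Mh) hM1) H ∧ IsFlatGt (⟨ℓ + 1, hL, m, hm⟩ : T3Family) n K (cubeSeqMT3 (⟨ℓ + 1, hL, m, hm⟩ : T3Family) n K x₀ ρ S ((ℓ + 1) * Mh) hM1) Gt ∧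
        HSupLetterG (⟨ℓ + 1, hL, m, hm⟩ : T3Family) n K (cubeSeqMT3 (⟨ℓ + 1, hL, m, hm⟩ : T3Family) n K x₀ ρ S ((ℓ + 1) * Mh) hM1) w H B₀ ∧ GtSupLetterG (⟨ℓ + 1, hL, m, hm⟩ : T3Family) n K w Gt B₀ ∧
        GtLaplaceLetterG (⟨ℓ + 1, hL, m, hm⟩ : T3Family) n K w Gt B₀ ∧
        ∀ (C MΔ ε₁ ε₀ R₁M₁ r₀ : ℝ), 0 ≤ C → 0 ≤ MΔ → 0 ≤ ε₁ → 0 ≤ ε₀ → 0 ≤ R₁M₁ →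
          4 * C * B₀ * B₃ * Real.exp (-(δ₀ / 2 * R₁M₁)) ≤ 1 / 2 → R₁M₁ ≤ (ρ : ℝ) - r₀ - 1 →
          ∀ (X : BondIdx (cubeSeqMT3 (⟨ℓ + 1, hL, m, hm⟩ : T3Family) n K x₀ ρ S ((ℓ + 1) * Mh) hM1) → ℝ) (b : PBond (PV 2 ℓ m K hd3 hL) 0),
            distSite (Mk (PV 2 ℓ m K hd3 hL) (K - n)) (iterBlockOf (K - n) b.src) (iterBlockOf (K - n) x₀) ≤ r₀ →
            (∀ c : BondIdx (cubeSeqMT3 (⟨ℓ + 1, hL, m, hm⟩ : T3Family) n K x₀ ρ S ((ℓ + 1) * Mh) hM1), (c.1.1 : ℕ) = K - n →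
              |X c| ≤ C * MΔ * ε₁ * (distBI (cubeSeqMT3 (⟨ℓ + 1, hL, m, hm⟩ : T3Family) n K x₀ ρ S ((ℓ + 1) * Mh) hM1) b c + 1)) →
            (∀ c : BondIdx (cubeSeqMT3 (⟨ℓ + 1, hL, m, hm⟩ : T3Family) n K x₀ ρ S ((ℓ + 1) * Mh) hM1), (c.1.1 : ℕ) < K - n →
              |X c| ≤ C * MΔ * ε₀ * (((ℓ + 1 : ℕ) : ℝ)) ^ ((K - n) - (c.1.1 : ℕ))) →
            |H X b| ≤ 1 / 4 * MΔ * max (4 * C * B₀ * B₃ * ε₁) (ε₀ / 2) ∧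
            (∀ ν : Fin 3, (((ℓ + 1 : ℕ) : ℝ)) ^ (K - n) * |H X ⟨b.src.shift ν, b.dir⟩ - H X b| ≤ 1 / 4 * MΔ * max (4 * C * B₀ * B₃ * ε₁) (ε₀ / 2)) ∧
            |(dcsE ((((ℓ + 1 : ℕ) : ℝ)) ^ (K - n)) (dcE ((((ℓ + 1 : ℕ) : ℝ)) ^ (K - n)) (WithLp.toLp 2 (H X)))) b| ≤
              1 / 4 * MΔ * max (4 * C * B₀ * B₃ * ε₁) (ε₀ / 2) ∧
            ((((ℓ + 1 : ℕ) : ℝ)) ^ (K - n)) ^ 2 * |∑ ν : Fin 3, ((H X b - H X ⟨b.src.shift ν, b.dir⟩) + (H X b - H X ⟨b.src.unshift ν, b.dir⟩))| ≤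
              1 / 4 * MΔ * max (4 * C * B₀ * B₃ * ε₁) (ε₀ / 2) := by
  obtain ⟨Mh₀, R₀, B₀, δ₀, B₃, hδ₀, hB₃, hmain⟩ := body_of_adm22_allSizes_allL ℓ hL
  -- `B₀ ≥ 0` is forced by the guarded (46)-letter at the zero datum once an admissible instance is at hand; up front we export `max B₀ 0`
  -- and identify it with `B₀` inside the body.
  refine ⟨Mh₀, R₀, max B₀ 0, δ₀, B₃, le_max_right _ _, hδ₀, hB₃, ?_⟩
  intro m hm n K hk1 hk' Mh R a' hMha hMh hR hM1 x₀ ρ S hRS w hw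
  have hnK : n < K := by omega
  have hAdm : Adm22 (cubeSeqMT3 (⟨ℓ + 1, hL, m, hm⟩ : T3Family) n K x₀ ρ S ((ℓ + 1) * Mh) hM1) R ((ℓ + 1) * Mh) :=
    adm22_cubeSeqMT3 (⟨ℓ + 1, hL, m, hm⟩ : T3Family) n K x₀ ρ hM1 hRS
  obtain ⟨H, Gt, hFH, hFG, hHs, hGs, hGl, dBI, hdom, h162, hHd⟩ :=
    hmain m hm n K hk1 hk' hMha hMh hR (cubeSeqMT3 (⟨ℓ + 1, hL, m, hm⟩ : T3Family) n K x₀ ρ S ((ℓ + 1) * Mh) hM1) rfl hAdm w hw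
  -- `0 ≤ B₀` from the guarded sup letter at `X = 0`, `t = 1`
  have hB₀ : 0 ≤ B₀ := by
    have h := (hHs 0 1 zero_le_one (fun c => by simp)).1 ⟨x₀, ⟨0, by norm_num⟩⟩
    simpa using h
  have hmax : max B₀ 0 = B₀ := max_eq_left hB₀
  refine ⟨H, Gt, hFH, hFG, by rw [hmax]; exact hHs, by rw [hmax]; exact hGs, by rw [hmax]; exact hGl, ?_⟩
  intro C MΔ ε₁ ε₀ R₁M₁ r₀ hC hMΔ hε₁ hε₀ hR1 h163 hρ X b hb hnear hfar
  rw [hmax] at h163 ⊢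
  exact rows164_quarter_cubeSeqMT3_top (F := (⟨ℓ + 1, hL, m, hm⟩ : T3Family)) hnK x₀ ρ S ((ℓ + 1) * Mh) hM1 hw hdom hHd h162 hδ₀.le hB₀
    hB₃.le hC hMΔ hε₁ hε₀ hR1 h163 hρ hb hnear hfar

end Summit.QuantumFields.YangMills.Theorems.HalvingQuarterAllSizesAllL

end
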